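import Summits.Langlands.Langlands.Theorems.PhantomRMYoshidaResiduallyYoshidaLiftingDefs

/-!
# `ResiduallyYoshidaLifting` (stmt-Langlands-13639) — Negative knowledge / structural lemmas hidden in `Sh`, I:
# the symplectic plane dichotomy (T12), `det² = ν⁴` (T16), non-conjugacy = Schur condition (T15, matrix half)

From the standing crux disprover (cdisprove gen 5, 2026-08-16; `Cruxes/ResiduallyYoshidaLifting/Disproof.lean`
§7).  Abstract linear algebra that every line on the crux uses informally, kernel-checked, with the crux-level
form of T12 stated over the picked line's `Sh` (landed in `PhantomRMYoshidaResiduallyYoshidaLiftingDefs`,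
namespace `…Cruxes.ResiduallyYoshidaLifting.YoshidaDivisorSelmerCount`):

* T12 `invariantPlane_lagrangian_or_split`, `sh_invariantPlane_lagrangian_or_split`: an invariant PLANE of a
  symplectic representation `r : Γ_ℚ → GL₄(K)` (`2 ≠ 0` in `K`) is LAGRANGIAN (`W^⊥ = W`) or SPLITS OFF
  (`K⁴ = W ⊕ W^⊥` with `W^⊥` invariant).  On the crux's residual type (`σ̄ ≇ σ̄'`, `det = ε̄⁻¹ =` multiplier)
  the Lagrangian case is excluded for planes of type `σ̄` (it forces `σ̄' ≅ σ̄^∨ ⊗ ε̄⁻¹ ≅ σ̄`), so reducible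
  symplectic deformations with an invariant plane are SPLIT (`σ ⊕ σ'`): the reducible (Yoshida) locus is the
  product of the two `GL₂` problems with matched determinant, and unimodular stable lattices reduce split.
* T16 `det_sq_eq_of_isSymplecticWithMultiplierFun`: `det ρ(g)² = ν(g)⁴` (`= ε(g)⁻⁴` for the crux).
* T15 `blockScalar_mem_gsp_iff`, `offDiagRotation_facts`: `diag(x,x,y,y) ∈ 𝔤𝔰𝔭(J₂ ⊕ J₂) ⇔ x = y`, and for
  `σ̄' = σ̄` a non-scalar trace-zero `𝔰𝔭`-equivariant endomorphism exists — the crux's non-conjugacy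
  hypothesis is exactly the Schur condition of the `GSp₄`-valued deformation problem at `σ̄ ⊕ σ̄'`.

Helper lemmas only (no positive route-item conclusion); hypothesis pricing for the lines, not objections.
Companion file: `ShGreenbergPlaneLine` (T13, T14). [folklore]
-/

noncomputable section

set_option linter.dupNamespace false

namespace Summit.Langlands.Langlands.Theorems.ResiduallyYoshidaLifting.Negative

open IsDedekindDomain
open Literature.NumberTheory.GaloisRepresentations
open Summit.Langlands.Langlands.Cruxes.ResiduallyYoshidaLifting.YoshidaDivisorSelmerCount (Sh)

section SymplecticPlane

open Module Submodule Matrix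

variable {k V : Type*} [Field k] [AddCommGroup V] [Module k V]

/-! ### T12 — SYMPLECTIC PLANE DICHOTOMY: an invariant plane of a symplectic `Sh`-representation is
Lagrangian or splits off; on the crux's residual type "reducible = split" -/

/-- Two vectors pairing non-trivially under an alternating form are linearly independent. [folklore] -/
theorem linearIndependent_pair_of_isAlt {B : LinearMap.BilinForm k V} (hB : B.IsAlt) {x y : V}
    (h : B x y ≠ 0) : LinearIndependent k ![x, y] := by
  rw [LinearIndependent.pair_iff]
  intro s t hst
  have h1 : s • B x y + t • B y y = 0 := by
    simpa only [map_add, map_smul, LinearMap.add_apply, LinearMap.smul_apply, map_zero,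
      LinearMap.zero_apply] using congrArg (fun v => B v y) hst
  have h2 : s • B x x + t • B x y = 0 := by
    simpa only [map_add, map_smul, map_zero] using congrArg (fun v => B x v) hst
  rw [hB y, smul_zero, add_zero, smul_eq_mul] at h1
  rw [hB x, smul_zero, zero_add, smul_eq_mul] at h2
  exact ⟨(mul_eq_zero.1 h1).resolve_right h, (mul_eq_zero.1 h2).resolve_right h⟩

/-- **Plane dichotomy.**  A plane `W` in an alternating space is either totally ISOTROPIC
(`B|_W = 0`) or NON-DEGENERATE (`B|_W` has trivial radical): `B|_W` is alternating on a
2-dimensional space, hence determined by one value `B(x₀, y₀)`. [folklore] -/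
theorem isotropic_or_nondegenerate_of_finrank_two {B : LinearMap.BilinForm k V} (hB : B.IsAlt)
    (W : Submodule k V) [FiniteDimensional k W] (hW : finrank k W = 2) :
    (∀ x ∈ W, ∀ y ∈ W, B x y = 0) ∨ (∀ x ∈ W, (∀ y ∈ W, B x y = 0) → x = 0) := by
  classical
  by_cases h : ∀ x ∈ W, ∀ y ∈ W, B x y = 0
  · exact Or.inl h
  refine Or.inr fun x hx hx0 => ?_
  push Not at h
  obtain ⟨x₀, hx₀, y₀, hy₀, hc⟩ := h
  have hli := linearIndependent_pair_of_isAlt hB hc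
  have hrange : Set.range ![x₀, y₀] = {x₀, y₀} := by
    simp only [Matrix.range_cons, Matrix.range_empty, Set.union_empty, Set.singleton_union]
  have hspan : span k ({x₀, y₀} : Set V) = W := by
    apply eq_of_le_of_finrank_eq
    · rw [span_le]
      rintro z hz
      rcases hz with rfl | rfl
      · exact hx₀
      · exact hy₀
    · rw [← hrange, finrank_span_eq_card hli, hW]
      simp
  have hxmem : x ∈ span k ({x₀, y₀} : Set V) := hspan ▸ hx
  obtain ⟨a, b, rfl⟩ := mem_span_pair.1 hxmem
  have e1 : a * B x₀ y₀ = 0 := by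
    have := hx0 y₀ hy₀
    simpa only [map_add, map_smul, LinearMap.add_apply, LinearMap.smul_apply, smul_eq_mul, hB y₀,
      mul_zero, add_zero] using this
  have e2 : b * B y₀ x₀ = 0 := by
    have := hx0 x₀ hx₀
    simpa only [map_add, map_smul, LinearMap.add_apply, LinearMap.smul_apply, smul_eq_mul, hB x₀,
      mul_zero, zero_add] using this
  have hc' : B y₀ x₀ ≠ 0 := by
    rw [← hB.neg_eq]
    exact neg_ne_zero.2 hc
  rw [(mul_eq_zero.1 e1).resolve_right hc, (mul_eq_zero.1 e2).resolve_right hc', zero_smul,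
    zero_smul, add_zero]

/-- ISOTROPIC planes of a non-degenerate alternating 4-space are LAGRANGIAN: `W^⊥ = W`. [folklore] -/
theorem orthogonal_eq_self_of_isotropic [FiniteDimensional k V] {B : LinearMap.BilinForm k V}
    (hBnd : B.Nondegenerate) (h4 : finrank k V = 4) {W : Submodule k V} (hW : finrank k W = 2)
    (hiso : ∀ x ∈ W, ∀ y ∈ W, B x y = 0) : B.orthogonal W = W := by
  symm
  apply eq_of_le_of_finrank_eq
  · intro m hm
    rw [LinearMap.BilinForm.mem_orthogonal_iff]
    exact fun n hn => hiso n hn m hm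
  · rw [LinearMap.BilinForm.finrank_orthogonal hBnd, h4, hW]

/-- NON-DEGENERATE planes split off: `V = W ⊕ W^⊥`. [folklore] -/
theorem isCompl_orthogonal_of_nondegenerate_plane [FiniteDimensional k V]
    {B : LinearMap.BilinForm k V} (hB : B.IsAlt) {W : Submodule k V}
    (hnd : ∀ x ∈ W, (∀ y ∈ W, B x y = 0) → x = 0) : IsCompl W (B.orthogonal W) := by
  apply LinearMap.BilinForm.isCompl_orthogonal_of_restrict_nondegenerate hB.isRefl
  constructor
  · rintro ⟨x, hx⟩ h
    exact Subtype.ext (hnd x hx fun y hy => by simpa using h ⟨y, hy⟩)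
  · rintro ⟨y, hy⟩ h
    refine Subtype.ext (hnd y hy fun x hx => ?_)
    have hxy : B x y = 0 := by simpa using h ⟨x, hx⟩
    exact hB.eq_iff.1 hxy

/-- A SIMILITUDE of `B` stabilising `W` stabilises `W^⊥`. [folklore] -/
theorem map_orthogonal_of_similitude {B : LinearMap.BilinForm k V} (T : V ≃ₗ[k] V) (ν : k)
    (hT : ∀ x y, B (T x) (T y) = ν * B x y) {W : Submodule k V} [FiniteDimensional k W]
    (hW : ∀ w ∈ W, T w ∈ W) : ∀ z ∈ B.orthogonal W, T z ∈ B.orthogonal W := by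
  have hmap : W.map (T : V →ₗ[k] V) = W := by
    apply eq_of_le_of_finrank_eq
    · rintro _ ⟨w, hw, rfl⟩
      exact hW w hw
    · exact LinearEquiv.finrank_map_eq T W
  intro z hz
  rw [LinearMap.BilinForm.mem_orthogonal_iff] at hz ⊢
  intro n hn
  rw [← hmap] at hn
  obtain ⟨n', hn', rfl⟩ := hn
  rw [LinearEquiv.coe_coe, hT, hz n' hn', mul_zero]

variable {n : ℕ}

/-- The matrix form `B_J(x, y) = xᵀ J y` of the crux's symplectic clause: `Jᵀ = -J` in
characteristic `≠ 2` (e.g. `ℚ̄_p`, or `𝔽̄_p` with `p` odd) gives an ALTERNATING form. [folklore] -/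
theorem isAlt_toBilin'_of_transpose_eq_neg {K : Type*} [Field K] [NeZero (2 : K)]
    {J : Matrix (Fin n) (Fin n) K} (hJ : Jᵀ = -J) : (Matrix.toBilin' J).IsAlt := by
  intro x
  have h : x ⬝ᵥ J *ᵥ x = -(x ⬝ᵥ J *ᵥ x) := by
    conv_lhs => rw [dotProduct_mulVec, dotProduct_comm, ← mulVec_transpose, hJ, neg_mulVec,
      dotProduct_neg]
  rw [Matrix.toBilin'_apply']
  have h2 : (2 : K) * (x ⬝ᵥ J *ᵥ x) = 0 := by linear_combination h
  exact (mul_eq_zero.1 h2).resolve_left (NeZero.ne 2)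

/-- `gᵀ J g = ν J` makes `v ↦ g v` a similitude of `B_J` with multiplier `ν`. [folklore] -/
theorem toBilin'_mulVec_mulVec {K : Type*} [Field K] {J g : Matrix (Fin n) (Fin n) K} {ν : K}
    (hg : gᵀ * J * g = ν • J) (x y : Fin n → K) :
    Matrix.toBilin' J (g *ᵥ x) (g *ᵥ y) = ν * Matrix.toBilin' J x y := by
  simp only [Matrix.toBilin'_apply']
  rw [mulVec_mulVec, dotProduct_mulVec, ← vecMul_transpose, vecMul_vecMul, ← Matrix.mul_assoc, hg,
    vecMul_smul, smul_dotProduct, smul_eq_mul, dotProduct_mulVec]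

/-- **T12. INVARIANT PLANES OF A SYMPLECTIC `Sh`-REPRESENTATION: LAGRANGIAN OR SPLIT.**  Let
`r : Γ_ℚ → GL₄(K)` (`K` a field with `2 ≠ 0`, e.g. `ℚ̄_p`; or `𝔽̄_p`, `p` odd, for the reduction of
a UNIMODULAR stable lattice) be symplectic with multiplier `ν` in the crux's sense
(`IsSymplecticWithMultiplierFun`: `∃ J, Jᵀ = -J, det J ∈ Kˣ, r(g)ᵀ J r(g) = ν(g) J`), and let
`W ⊆ K⁴` be an `r`-invariant PLANE.  Then for `B = B_J`: EITHER `W` is Lagrangian (`W^⊥ = W`; then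
`B_J` is a perfect `r`-equivariant pairing `W × K⁴/W → K(ν)`, so `K⁴/W ≅ W^∨ ⊗ ν` and
`det(r|_W) · det(r|_{K⁴/W}) = ν²`), OR `K⁴ = W ⊕ W^⊥` with `W^⊥` ALSO `r`-invariant: `r` SPLITS as an
orthogonal sum of two symplectic planes, each with multiplier `ν` (so `det = ν` on each).

CONSEQUENCES FOR THE CRUX (residual pair `σ̄ ≇ σ̄'`, `det σ̄ = det σ̄' = ε̄⁻¹ = ν̄`):
(i) "REDUCIBLE = SPLIT": a reducible symplectic deformation `ρ_A` of the Yoshida type over any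
`A` (take `K = Frac` of a quotient domain) with an invariant plane lifting `σ̄` cannot be Lagrangian
— that would give `σ̄' ≅ σ̄^∨ ⊗ ε̄⁻¹ ≅ σ̄ ⊗ (det σ̄)⁻¹ ε̄⁻¹ = σ̄` — so it is `σ ⊕ σ'`: the reducible
locus `Y = V(I)` of every line is EXACTLY the image of the two `GL₂` ordinary problems with
matched determinant, with NO extension (`Ext¹(σ', σ)`) directions inside it; the off-diagonal
classes `H¹(ℚ, σ̄ ⊗ σ̄' ⊗ ε̄)` are transverse to `Y` (first-order deformations towards irreducible
points), which is why `I/I²`, not a reducible sub-family, carries the Selmer information (line 1),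
and why `R/I ≅ (R_σ̄ ⊗̂ R_σ̄')^{det}` needs integral big `R^{ord} = T^{ord}` for BOTH constituents to
give the datum's `K ≤ I` (known under Taylor–Wiles adequacy of `σ̄|_{ℚ(ζ_p)}`; in regime (c) of §6
only pointwise modularity à la Skinner–Wiles 2001 is available).
(ii) UNIMODULAR LATTICES REDUCE SPLIT: for a self-dual stable lattice `Λ` of an irreducible
`Sh`-`ρ`, `ρ̄_Λ` is symplectic non-degenerate over `𝔽̄_p`; any `Γ_ℚ`-stable plane (one exists, `ρ̄^ss`
having two 2-dimensional constituents) is Lagrangian or split, and Lagrangian is excluded as in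
(i) — so `ρ̄_Λ ≅ σ̄ ⊕ σ̄'` SPLIT (line 2's `stub_residualYoshidaSplitting`; the non-split reductions
supplied by Ribet's lemma live on NON-unimodular lattices, where the reduced pairing degenerates).
(iii) Hence the residual object every symplectic deformation argument starts from is the SPLIT
`σ̄ ⊕ σ̄'`: `End_{k[Γ]}(σ̄ ⊕ σ̄') = k × k` (Mazur's `GL₄`-condition fails —
`Literature.Barriers.Langlands.ResiduallyReducibleBarrier`, `not_centralizerIsScalars`), but its
intersection with `𝔤𝔰𝔭(J)` is the scalars (`diag(x,x,y,y) ∈ 𝔤𝔰𝔭(J₂ ⊕ J₂) ⇔ x = y`): the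
`GSp₄`-valued problem is Schur (`H⁰(Γ, ad⁰_{𝔰𝔭}) = 0`) EXACTLY BECAUSE `σ̄ ≇ σ̄'` — for `σ̄' = σ̄`,
`I₂ ⊗ A` with `A ∈ 𝔰𝔬₂` is a non-scalar trace-zero `𝔰𝔭`-equivariant endomorphism.  So the crux's
non-conjugacy hypothesis `hnc` is decoration for TRUTH ((B) covers `σ̄ ⊕ σ̄`) but load-bearing for
every ENGINE (representability / Schur-ness of the symplectic deformation problem). [folklore] -/
theorem invariantPlane_lagrangian_or_split {K : Type} [Field K] [TopologicalSpace K]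
    [IsTopologicalRing K] [NeZero (2 : K)] (r : FramedGaloisRep ℚ K 4)
    {ν : Field.absoluteGaloisGroup ℚ → K} (hr : r.IsSymplecticWithMultiplierFun ν)
    (W : Submodule K (Fin 4 → K)) (hW : finrank K W = 2)
    (hinv : ∀ g, ∀ w ∈ W, r.toGaloisRep g w ∈ W) :
    ∃ J : Matrix (Fin 4) (Fin 4) K, Jᵀ = -J ∧ J.det ≠ 0 ∧
      (∀ g, (r g).valᵀ * J * (r g).val = ν g • J) ∧
      (((Matrix.toBilin' J).orthogonal W = W) ∨
        (IsCompl W ((Matrix.toBilin' J).orthogonal W) ∧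
          ∀ g, ∀ z ∈ (Matrix.toBilin' J).orthogonal W,
            r.toGaloisRep g z ∈ (Matrix.toBilin' J).orthogonal W)) := by
  obtain ⟨J, hJt, hJu, hJ⟩ := hr
  have hdet : J.det ≠ 0 := hJu.ne_zero
  refine ⟨J, hJt, hdet, hJ, ?_⟩
  have hAlt := isAlt_toBilin'_of_transpose_eq_neg hJt
  have hNd : (Matrix.toBilin' J).Nondegenerate :=
    LinearMap.BilinForm.nondegenerate_toBilin'_of_det_ne_zero' J hdet
  have h4 : finrank K (Fin 4 → K) = 4 := by simp
  rcases isotropic_or_nondegenerate_of_finrank_two hAlt W hW with hiso | hnd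
  · exact Or.inl (orthogonal_eq_self_of_isotropic hNd h4 hW hiso)
  · refine Or.inr ⟨isCompl_orthogonal_of_nondegenerate_plane hAlt hnd, fun g => ?_⟩
    let T : (Fin 4 → K) ≃ₗ[K] (Fin 4 → K) :=
      LinearMap.GeneralLinearGroup.toLinearEquiv (Matrix.GeneralLinearGroup.toLin (r g))
    have hTapp : ∀ v, T v = (r g).val *ᵥ v := fun v => by
      simp [T, Matrix.GeneralLinearGroup.coe_toLin]
    have hsim : ∀ x y, Matrix.toBilin' J (T x) (T y) = ν g * Matrix.toBilin' J x y := fun x y => by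
      rw [hTapp, hTapp]; exact toBilin'_mulVec_mulVec (hJ g) x y
    have hTW : ∀ w ∈ W, T w ∈ W := fun w hw => by rw [hTapp]; exact hinv g w hw
    intro z hz
    have := map_orthogonal_of_similitude T (ν g) hsim hTW z hz
    rwa [hTapp] at this

/-- T12 for the crux's `Sh ρ` verbatim (`ℚ̄_p` has characteristic `0`). [folklore] -/
theorem sh_invariantPlane_lagrangian_or_split {p : ℕ} [Fact p.Prime] {k' : Type} [Field k']
    [TopologicalSpace k'] {red : Valued.integer (PadicAlgCl p) →+* k'} {σ σ' : FramedGaloisRep ℚ k' 2}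
    {ρ : FramedGaloisRep ℚ (PadicAlgCl p) 4} (hSh : Sh p k' red σ σ' ρ)
    (W : Submodule (PadicAlgCl p) (Fin 4 → PadicAlgCl p)) (hW : finrank (PadicAlgCl p) W = 2)
    (hinv : ∀ g, ∀ w ∈ W, ρ.toGaloisRep g w ∈ W) :
    ∃ J : Matrix (Fin 4) (Fin 4) (PadicAlgCl p), Jᵀ = -J ∧ J.det ≠ 0 ∧
      (∀ g, (ρ g).valᵀ * J * (ρ g).val =
        (algebraMap ℚ_[p] (PadicAlgCl p)
          ((((GaloisRep.cyclotomicCharacter ℚ p g)⁻¹ : ℤ_[p]ˣ) : ℤ_[p]) : ℚ_[p])) • J) ∧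
      (((Matrix.toBilin' J).orthogonal W = W) ∨
        (IsCompl W ((Matrix.toBilin' J).orthogonal W) ∧
          ∀ g, ∀ z ∈ (Matrix.toBilin' J).orthogonal W,
            ρ.toGaloisRep g z ∈ (Matrix.toBilin' J).orthogonal W)) :=
  haveI : NeZero (2 : PadicAlgCl p) := ⟨two_ne_zero⟩
  invariantPlane_lagrangian_or_split ρ hSh.1 W hW hinv

end SymplecticPlane

section SymplecticShape

open Module Submodule Matrix

/-! ### T16 — `det(r)² = ν⁴` for a symplectic `r` of rank 4 -/

/-- `gᵀ J g = ν J` with `det J ≠ 0` gives `det(g)² = νⁿ`. [folklore] -/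
theorem det_sq_eq_of_symplectic {R : Type*} [CommRing R] [IsDomain R] {n : ℕ}
    {J g : Matrix (Fin n) (Fin n) R} {ν : R} (hJ : J.det ≠ 0) (hg : gᵀ * J * g = ν • J) :
    g.det ^ 2 = ν ^ n := by
  have h := congrArg Matrix.det hg
  rw [det_mul, det_mul, det_transpose, det_smul, Fintype.card_fin] at h
  have h' : (g.det ^ 2 - ν ^ n) * J.det = 0 := by linear_combination h
  exact sub_eq_zero.1 ((mul_eq_zero.1 h').resolve_right hJ)

/-- For the crux: `det ρ(g)² = ε(g)⁻⁴`, i.e. `det ρ = ± ε⁻²` pointwise (the sign is `+`: `GSp₄` is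
connected / Pfaffian, not formalised). [folklore] -/
theorem det_sq_eq_of_isSymplecticWithMultiplierFun {K' : Type} [Field K'] [TopologicalSpace K']
    (r : FramedGaloisRep ℚ K' 4) {ν : Field.absoluteGaloisGroup ℚ → K'}
    (hr : r.IsSymplecticWithMultiplierFun ν) (g : Field.absoluteGaloisGroup ℚ) :
    (r g).val.det ^ 2 = ν g ^ 4 := by
  obtain ⟨J, -, hJu, hJ⟩ := hr
  exact det_sq_eq_of_symplectic hJu.ne_zero (hJ g)

/-! ### T15 — the non-conjugacy hypothesis is the Schur condition of the `GSp₄` problem (matrix half) -/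

/-- The standard alternating `2 × 2` matrix. [folklore] -/
def J₂ (R : Type*) [CommRing R] : Matrix (Fin 2) (Fin 2) R := !![0, 1; -1, 0]

/-- The Yoshida-type form: orthogonal sum of two symplectic planes. [folklore] -/
def J₄ (R : Type*) [CommRing R] : Matrix (Fin 2 ⊕ Fin 2) (Fin 2 ⊕ Fin 2) R :=
  Matrix.fromBlocks (J₂ R) 0 0 (J₂ R)

/-- Block-scalar endomorphism `diag(x, x, y, y)` — the general element of `End_{k[Γ]}(σ̄ ⊕ σ̄')`
(`= k × k`) for non-conjugate absolutely irreducible `σ̄, σ̄'`. [folklore] -/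
def blockScalar {R : Type*} [CommRing R] (x y : R) : Matrix (Fin 2 ⊕ Fin 2) (Fin 2 ⊕ Fin 2) R :=
  Matrix.fromBlocks (x • (1 : Matrix (Fin 2) (Fin 2) R)) 0 0 (y • 1)

/-- (a) `diag(x, x, y, y) ∈ 𝔤𝔰𝔭(J₄)` (`Xᵀ J + J X = μ J`) iff `x = y` (and `μ = 2x`): the
`𝔤𝔰𝔭`-commutant of `σ̄ ⊕ σ̄'` is the scalars, `H⁰(ad⁰_{𝔰𝔭}) = 0` — the `GSp₄` deformation problem at
the crux's residual type is Schur BECAUSE `σ̄ ≇ σ̄'`. [folklore] -/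
theorem blockScalar_mem_gsp_iff {R : Type*} [CommRing R] [IsDomain R] [NeZero (2 : R)] (x y μ : R) :
    (blockScalar x y)ᵀ * J₄ R + J₄ R * blockScalar x y = μ • J₄ R ↔ (μ = 2 * x ∧ x = y) := by
  constructor
  · intro h
    have e1 := congrFun (congrFun h (Sum.inl 0)) (Sum.inl 1)
    have e2 := congrFun (congrFun h (Sum.inr 0)) (Sum.inr 1)
    simp [blockScalar, J₄, J₂, Matrix.fromBlocks_transpose, Matrix.fromBlocks_multiply] at e1 e2
    constructor
    · linear_combination -e1
    · have : (2 : R) * (x - y) = 0 := by linear_combination e1 - e2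
      exact sub_eq_zero.1 ((mul_eq_zero.1 this).resolve_left (NeZero.ne 2))
  · rintro ⟨rfl, rfl⟩
    ext i j
    rcases i with i | i <;> rcases j with j | j <;> fin_cases i <;> fin_cases j <;>
      simp [blockScalar, J₄, J₂, Matrix.fromBlocks_transpose, Matrix.fromBlocks_multiply] <;> ring

/-- The multiplicity-space rotation `[[0, aI], [-aI, 0]]`. [folklore] -/
def offDiagRotation {R : Type*} [CommRing R] (a : R) : Matrix (Fin 2 ⊕ Fin 2) (Fin 2 ⊕ Fin 2) R :=
  Matrix.fromBlocks 0 (a • (1 : Matrix (Fin 2) (Fin 2) R)) (-(a • 1)) 0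

/-- (b) WITHOUT non-conjugacy (`σ̄' = σ̄`, image inside `{diag(A, A)}`): `offDiagRotation a` commutes
with every `diag(A, A)`, lies in `𝔰𝔭(J₄)` (`Xᵀ J + J X = 0`), has trace `0`, and is not scalar for
`a ≠ 0` — `H⁰(Γ, ad⁰_{𝔰𝔭}(σ̄ ⊕ σ̄)) ≠ 0`: the `GSp₄` problem is NOT Schur. [folklore] -/
theorem offDiagRotation_facts {R : Type*} [CommRing R] (a : R) (A : Matrix (Fin 2) (Fin 2) R) :
    offDiagRotation a * Matrix.fromBlocks A 0 0 A = Matrix.fromBlocks A 0 0 A * offDiagRotation a ∧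
      (offDiagRotation a)ᵀ * J₄ R + J₄ R * offDiagRotation a = 0 ∧ (offDiagRotation a).trace = 0 ∧
      (a ≠ 0 → ∀ c : R, offDiagRotation a ≠ c • (1 : Matrix (Fin 2 ⊕ Fin 2) (Fin 2 ⊕ Fin 2) R)) := by
  refine ⟨?_, ?_, ?_, ?_⟩
  · simp [offDiagRotation, Matrix.fromBlocks_multiply]
  · simp [offDiagRotation, J₄, Matrix.fromBlocks_transpose, Matrix.fromBlocks_multiply,
      Matrix.fromBlocks_add, Matrix.transpose_neg]
  · simp [offDiagRotation, Matrix.trace, Matrix.fromBlocks]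
  · intro ha c h
    have e := congrFun (congrFun h (Sum.inl 0)) (Sum.inr 0)
    simp [offDiagRotation, Matrix.smul_apply] at e
    exact ha e



end SymplecticShape

end Summit.Langlands.Langlands.Theorems.ResiduallyYoshidaLifting.Negative

end
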